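import Summits.AtomisticToContinuum.HydrodynamicLimit.Theses.ChapmanEnskogBBGKY

/-!
# Route ChapmanEnskogBBGKY — typed decomposition of the crux `ContactBilinearEntropyBound`
# (stmt-AtomisticToContinuum-11892; crux-strategist BC2-redirect, `--supports`)

The crux `Summit.AtomisticToContinuum.HydrodynamicLimit.Theses.ChapmanEnskogBBGKY.ContactBilinearEntropyBound`
bounds the σ³-weighted BILINEAR CONTACT functional
`Q_N = ∫_(0,t) σ³ ∫_𝕋³ ∫_S² ∫∫ (1+|v₁|²+|v|²)|v−v₁| |δF(x,v₁)| |δF(x+ε_N ω,v)| dv dv₁ dω dx ds`,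
`δF = F¹_N(s) − ρ_s·M_(1,θ_s,u_s)` (one-body marginal of the transported canonical density minus the
Euler local Maxwellian), by `C·(∫_(0,t) klDiv(law_s ‖ localGibbsLaw σ (a s) (u s) (θ s)) ds)/(N+1) + δ_N`,
`δ_N → 0`, for every continuous positive activity profile `a`.

This file types three pieces of DIFFERENT mathematical nature and proves that together they give
the crux verbatim (`contactBilinearEntropyBound_of_subs`):

* `ContactOnePointReduction` (kinematic, entropy-free, every `σ > 0`): with the cubic weight
  `w(v) = (1+|v|²)(1+|v|)`, the own-density velocity deviation
  `S^vel_N = ∫_(0,t)∫_x (∫ w(v) |F¹_N(s,x,v) − ρ_F(s,x) M_(1,θ_s(x),u_s(x))(v)| dv)² dx ds`,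
  `ρ_F(s,x) = ∫ F¹_N(s,x,v) dv`, and the density deviation `S^den_N = ∫_(0,t)∫_x (ρ_F(s,x) − ρ_s(x))² dx ds`,
  one has `Q_N ≤ C·(S^vel_N + S^den_N) + δ_N`. Mechanism: `(1+|v₁|²+|v|²)|v−v₁| ≤ w(v₁)w(v)`
  factorises the `(v₁,v)` integral into `g(x)·g(x+ε_Nω)`, `g = ∫ w|δF| dv`; AM–GM and the
  translation invariance of Lebesgue measure on `𝕋³` remove the contact displacement,
  `∫∫ g(x)g(x+εω) ≤ |S²| ∫ g²`; finally `|δF| ≤ |F¹ − ρ_F M| + |ρ_F − ρ| M` and `(a+b)² ≤ 2a²+2b²`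
  with `sup_(s≤t,x) ∫ w M_(1,θ_s(x),u_s(x)) < ∞`.
* `VelocityDeviationEntropyBound` (velocity sector): `S^vel_N ≤ C·∫klDiv/(N+1) + δ_N`. Expected road:
  Hellinger, `(∫ w|f−m|)² ≤ 2∫w²(f+m)·∫(√f−√m)² ≤ 2∫w²(f+m)·KL(f‖m)` per point `x`, an `L∞_x` bound on the
  sixth velocity moments of `F¹_N` (⇐ the support item `OneBodyGaussianBound`), and the EXACT chain
  rule/superadditivity for the velocity conditionals of the reference local Gibbs law (conditionally on
  positions its velocities are independent Maxwellians `M_(1,θ_s(x_i),u_s(x_i))`, for ANY activity `a`):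
  `(N+1)·KL(F¹ ‖ ρ_F ⊗ M) ≤ klDiv(law_s ‖ localGibbs_s)` by exchangeability.
* `DensityDeviationEntropyBound` (density sector): `S^den_N ≤ C·∫klDiv/(N+1) + δ_N`. Expected road: the
  entropy inequality for linear density functionals optimised in the direction `ρ_F − ρ_ref`, the uniform
  low-density cluster expansion of the hard-core reference (pressure with bounded tilts; engines of
  `LocalGibbsConcentration`), an `L∞_x` one-body density bound (⇐ `OneBodyGaussianBound`), and — for
  activity profiles whose Gibbs density profile is not `ρ_s` — the exact mass conservation of the
  hard-sphere flow plus uniqueness for the linear continuity equation `∂ρ' + div(ρ'u) = 0` with Euler's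
  smooth `u` and the `t = 0` tie (which forces `liminf klDiv/(N+1) > 0` along such profiles).

The assembly is the composition of the three asymptotic linear bounds through the two interpolating
one-point functionals `S^vel, S^den` (constants multiply/add, the `o(1)` errors combine to
`C₁(δ₂+δ₃)+δ₁ → 0`, the two `σ₀` thresholds are minimised): `asymptoticBound_chain` (abstract, in `ℝ≥0∞`)
and `contactBilinearEntropyBound_of_subs` (instantiation on the route's objects; the `let`-bound
objects `G, ε, P, W, F1, M, Q` are the crux's, byte for byte).
-/

noncomputable section

open MeasureTheory Filter Set Topology
open scoped ENNReal NNReal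

namespace Summit.AtomisticToContinuum.HydrodynamicLimit.Theorems

/-- **Piece 1 — `ContactOnePointReduction` (kinematic contact → one-point reduction; every `σ > 0`, no
entropy, no `t = 0` tie).** With `w(v) = (1+‖v‖²)(1+‖v‖)`, `ρ_F(s,x) = ∫ F¹_N(s,x,v) dv`,
`S^vel_N = ∫_(0,t)∫_x (∫⁻ w|F¹_N − ρ_F·M_(1,θ_s,u_s)| dv)²`, `S^den_N = ∫_(0,t)∫_x (ρ_F − ρ_s)²`:
`∃ C, δ_N → 0, ∀ N, Q_N ≤ C·(S^vel_N + S^den_N) + δ_N` (`Q_N` the crux's bilinear contact functional,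
verbatim). Weight factorisation `(1+|v₁|²+|v|²)|v−v₁| ≤ w(v₁)w(v)`, Tonelli, AM–GM, translation
invariance of `volume` on `𝕋³`, `|δF| ≤ |F¹−ρ_F M| + |ρ_F−ρ|M`, `(a+b)² ≤ 2(a²+b²)`, Gaussian
moments of `M` uniformly on `[0,t] × 𝕋³`. [folklore] -/
def ContactOnePointReduction : Prop :=
  ∀ (a₀ θ₀ : Literature.MathematicalPhysics.KineticTheory.T3 → ℝ) (u₀ : Literature.MathematicalPhysics.KineticTheory.T3 → Literature.MathematicalPhysics.KineticTheory.V3), Continuous a₀ → Continuous θ₀ → Continuous u₀ → (∀ x, 0 < a₀ x) → (∀ x, 0 < θ₀ x) → ∀ σ : ℝ, 0 < σ → ∀ (T : ℝ) (ρ θ : ℝ → Literature.MathematicalPhysics.KineticTheory.T3 → ℝ) (u : ℝ → Literature.MathematicalPhysics.KineticTheory.T3 → Literature.MathematicalPhysics.KineticTheory.V3), Literature.MathematicalPhysics.KineticTheory.IsHardSphereEulerSolution σ T ρ u θ → ∀ Φ : (N : ℕ) → Literature.Analysis.FluidPDE.HardSphereFlow (Literature.Analysis.FluidPDE.Torus.geometry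 (Fin 3)) (Literature.MathematicalPhysics.KineticTheory.hsDiameter σ N) (N + 1), (∀ N, Measurable (fun p : ℝ × Literature.Analysis.FluidPDE.Config (N + 1) (Fin 3) Literature.MathematicalPhysics.KineticTheory.T3 => (Φ N).flow p.1 p.2)) → ∀ t ∈ Set.Ico 0 T, let G : Literature.Analysis.FluidPDE.Geometry (Fin 3) Literature.MathematicalPhysics.KineticTheory.T3 := Literature.Analysis.FluidPDE.Torus.geometry (Fin 3); let ε : ℕ → ℝ := fun N => Literature.MathematicalPhysics.KineticTheory.hsDiameter σ N; let W : (N : ℕ) → ℝ → Literature.Analysis.FluidPDE.Config (N + 1) (Fin 3) Literature.MathematicalPhysics.KineticTheory.T3 → ℝ := fun N s => (Literature.Analysis.FluidPDE.hardSphereDomain G (N + 1) (ε N)).indicator (Literature.Analysis.FluidPDE.hsTransport (Φ N) s (Literature.Analysis.FluidPDE.canonicalDensity G (ε N) (N + 1) (Literature.MathematicalPhysics.KineticTheory.localGibbsProfile a₀ u₀ θ₀))); let F1 : ℕ → ℝ → Literature.MathematicalPhysics.KineticTheory.T3 × Literature.MathematicalPhysics.KineticTheory.V3 → ℝ := fun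 N s y => Literature.Analysis.FluidPDE.nthMarginal (N + 1) 1 (W N s) (fun _ => y); let M : ℝ → Literature.MathematicalPhysics.KineticTheory.T3 × Literature.MathematicalPhysics.KineticTheory.V3 → ℝ := fun s y => ρ s y.1 * Literature.Analysis.FluidPDE.localMaxwellian 1 (θ s y.1) (u s y.1) y.2; let w : Literature.MathematicalPhysics.KineticTheory.V3 → ℝ := fun v => (1 + ‖v‖ ^ 2) * (1 + ‖v‖); let ρF : ℕ → ℝ → Literature.MathematicalPhysics.KineticTheory.T3 → ℝ := fun N s x => ∫ v, F1 N s (x, v); let Svel : ℕ → ENNReal := fun N => ∫⁻ s in Set.Ioo 0 t, ∫⁻ x : Literature.MathematicalPhysics.KineticTheory.T3, (∫⁻ v : Literature.MathematicalPhysics.KineticTheory.V3, ENNReal.ofReal (w v * |F1 N s (x, v) - ρF N s x * Literature.Analysis.FluidPDE.localMaxwellian 1 (θ s x) (u s x) v|)) ^ 2; let Sden : ℕ → ENNReal := fun N => ∫⁻ s in Set.Ioo 0 t, ∫⁻ x : Literature.MathematicalPhysics.KineticTheory.T3, ENNReal.ofReal ((ρF N s x - ρ s x) ^ 2); let Q :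 ℕ → ENNReal := fun N => ∫⁻ s in Set.Ioo 0 t, ∫⁻ x : Literature.MathematicalPhysics.KineticTheory.T3, ∫⁻ ω : Metric.sphere (0 : Literature.MathematicalPhysics.KineticTheory.V3) 1, (∫⁻ v₁ : Literature.MathematicalPhysics.KineticTheory.V3, ∫⁻ v : Literature.MathematicalPhysics.KineticTheory.V3, ENNReal.ofReal (σ ^ 3 * ((1 + ‖v₁‖ ^ 2 + ‖v‖ ^ 2) * ‖v - v₁‖ * |F1 N s (x, v₁) - M s (x, v₁)| * |F1 N s (G.translate x (ε N • (ω : Literature.MathematicalPhysics.KineticTheory.V3)), v) - M s (G.translate x (ε N • (ω : Literature.MathematicalPhysics.KineticTheory.V3)), v)|))) ∂Literature.MathematicalPhysics.KineticTheory.sphereMeasure; ∃ C : NNReal, ∃ δ : ℕ → ENNReal, Filter.Tendsto δ Filter.atTop (nhds 0) ∧ ∀ N : ℕ, Q N ≤ (C : ENNReal) * (Svel N + Sden N) + δ N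

/-- **Piece 2 — `VelocityDeviationEntropyBound` (velocity sector).** Same setting as the crux; for
every continuous positive activity profile `a`: `∃ C, δ_N → 0, ∀ N,
S^vel_N ≤ C·(∫_(0,t) klDiv(law_s ‖ localGibbsLaw σ (a s) (u s) (θ s)) ds)/(N+1) + δ_N`, where
`S^vel_N = ∫_(0,t)∫_x (∫⁻ (1+‖v‖²)(1+‖v‖)·|F¹_N(s,x,v) − ρ_F(s,x)·M_(1,θ_s(x),u_s(x))(v)| dv)² dx ds` is
the squared cubic-weighted `L¹_v` deviation of the one-body marginal from the local Maxwellian WITH ITS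
OWN DENSITY `ρ_F = ∫F¹ dv` (no Euler density, no contact displacement). Hellinger
`(∫w|f−m|)² ≤ 2∫w²(f+m)·KL(f‖m)`, `L∞_x` sixth moments of `F¹_N`, exact velocity chain rule +
exchangeability `(N+1)·KL(F¹ ‖ ρ_F⊗M) ≤ klDiv(law_s ‖ localGibbs_s)` (any activity `a`).
[cite: Yau1991, §2] [cite: KipnisLandim1999, Ch. 6 §1] -/
def VelocityDeviationEntropyBound : Prop :=
  ∀ (a₀ θ₀ : Literature.MathematicalPhysics.KineticTheory.T3 → ℝ) (u₀ : Literature.MathematicalPhysics.KineticTheory.T3 → Literature.MathematicalPhysics.KineticTheory.V3), Continuous a₀ → Continuous θ₀ → Continuous u₀ → (∀ x, 0 < a₀ x) → (∀ x, 0 < θ₀ x) → ∃ σ₀ : ℝ, 0 < σ₀ ∧ ∀ σ : ℝ, 0 < σ → σ < σ₀ → ∀ (T : ℝ) (ρ θ : ℝ → Literature.MathematicalPhysics.KineticTheory.T3 → ℝ) (u : ℝ → Literature.MathematicalPhysics.KineticTheory.T3 → Literature.MathematicalPhysics.KineticTheory.V3), Literature.MathematicalPhysics.KineticTheory.IsHardSphereEulerSolution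 σ T ρ u θ → ∀ Φ : (N : ℕ) → Literature.Analysis.FluidPDE.HardSphereFlow (Literature.Analysis.FluidPDE.Torus.geometry (Fin 3)) (Literature.MathematicalPhysics.KineticTheory.hsDiameter σ N) (N + 1), (∀ N, Measurable (fun p : ℝ × Literature.Analysis.FluidPDE.Config (N + 1) (Fin 3) Literature.MathematicalPhysics.KineticTheory.T3 => (Φ N).flow p.1 p.2)) → Literature.MathematicalPhysics.KineticTheory.TendstoHydroFieldsAt (fun N => Literature.MathematicalPhysics.KineticTheory.localGibbsLaw σ a₀ u₀ θ₀ N (Φ N)) Φ ρ u θ 0 → ∀ t ∈ Set.Ico 0 T, ∀ a : ℝ → Literature.MathematicalPhysics.KineticTheory.T3 → ℝ, Continuous (fun p : ℝ × Literature.MathematicalPhysics.KineticTheory.T3 => a p.1 p.2) → (∀ s x, 0 < a s x) → let G : Literature.Analysis.FluidPDE.Geometry (Fin 3) Literature.MathematicalPhysics.KineticTheory.T3 := Literature.Analysis.FluidPDE.Torus.geometry (Fin 3); let ε : ℕ → ℝ := fun N => Literature.MathematicalPhysics.KineticTheory.hsDiameter σ N; let P : (N : ℕ) → MeasureTheory.Measure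 (Literature.Analysis.FluidPDE.Config (N + 1) (Fin 3) Literature.MathematicalPhysics.KineticTheory.T3) := fun N => Literature.MathematicalPhysics.KineticTheory.localGibbsLaw σ a₀ u₀ θ₀ N (Φ N); let W : (N : ℕ) → ℝ → Literature.Analysis.FluidPDE.Config (N + 1) (Fin 3) Literature.MathematicalPhysics.KineticTheory.T3 → ℝ := fun N s => (Literature.Analysis.FluidPDE.hardSphereDomain G (N + 1) (ε N)).indicator (Literature.Analysis.FluidPDE.hsTransport (Φ N) s (Literature.Analysis.FluidPDE.canonicalDensity G (ε N) (N + 1) (Literature.MathematicalPhysics.KineticTheory.localGibbsProfile a₀ u₀ θ₀))); let F1 : ℕ → ℝ → Literature.MathematicalPhysics.KineticTheory.T3 × Literature.MathematicalPhysics.KineticTheory.V3 → ℝ := fun N s y => Literature.Analysis.FluidPDE.nthMarginal (N + 1) 1 (W N s) (fun _ => y); let w : Literature.MathematicalPhysics.KineticTheory.V3 → ℝ := fun v => (1 + ‖v‖ ^ 2) * (1 + ‖v‖); let ρF : ℕ → ℝ → Literature.MathematicalPhysics.KineticTheory.T3 → ℝ := fun N s x => ∫ v, F1 N s (x, v); let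 Svel : ℕ → ENNReal := fun N => ∫⁻ s in Set.Ioo 0 t, ∫⁻ x : Literature.MathematicalPhysics.KineticTheory.T3, (∫⁻ v : Literature.MathematicalPhysics.KineticTheory.V3, ENNReal.ofReal (w v * |F1 N s (x, v) - ρF N s x * Literature.Analysis.FluidPDE.localMaxwellian 1 (θ s x) (u s x) v|)) ^ 2; ∃ C : NNReal, ∃ δ : ℕ → ENNReal, Filter.Tendsto δ Filter.atTop (nhds 0) ∧ ∀ N : ℕ, Svel N ≤ (C : ENNReal) * (∫⁻ s in Set.Ioo 0 t, InformationTheory.klDiv ((Φ N).lawAt (P N) s) (Literature.MathematicalPhysics.KineticTheory.localGibbsLaw σ (a s) (u s) (θ s) N (Φ N))) / ((N : ENNReal) + 1) + δ N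

/-- **Piece 3 — `DensityDeviationEntropyBound` (density sector).** Same setting as the crux; for every
continuous positive activity profile `a`: `∃ C, δ_N → 0, ∀ N,
S^den_N ≤ C·(∫_(0,t) klDiv(law_s ‖ localGibbsLaw σ (a s) (u s) (θ s)) ds)/(N+1) + δ_N`, where
`S^den_N = ∫_(0,t)∫_x (ρ_F(s,x) − ρ_s(x))² dx ds`, `ρ_F(s,x) = ∫ F¹_N(s,x,v) dv` the one-body density of
the true evolution and `ρ_s` the Euler density. Entropy inequality for linear density functionals in the
direction `ρ_F − ρ_ref`, uniform low-density cluster expansion of the hard-core reference, `L∞_x` density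
bound; for activities with `ρ[a_s] ≠ ρ_s`, exact mass conservation + uniqueness for `∂ρ' + div(ρ'u) = 0`
with the `t = 0` tie gives `liminf klDiv/(N+1) > 0`. [cite: Yau1991, §2] [cite: KipnisLandim1999, Ch. 6 §1]
[cite: Ruelle1969, §3.4] -/
def DensityDeviationEntropyBound : Prop :=
  ∀ (a₀ θ₀ : Literature.MathematicalPhysics.KineticTheory.T3 → ℝ) (u₀ : Literature.MathematicalPhysics.KineticTheory.T3 → Literature.MathematicalPhysics.KineticTheory.V3), Continuous a₀ → Continuous θ₀ → Continuous u₀ → (∀ x, 0 < a₀ x) → (∀ x, 0 < θ₀ x) → ∃ σ₀ : ℝ, 0 < σ₀ ∧ ∀ σ : ℝ, 0 < σ → σ < σ₀ → ∀ (T : ℝ) (ρ θ : ℝ → Literature.MathematicalPhysics.KineticTheory.T3 → ℝ) (u : ℝ → Literature.MathematicalPhysics.KineticTheory.T3 → Literature.MathematicalPhysics.KineticTheory.V3), Literature.MathematicalPhysics.KineticTheory.IsHardSphereEulerSolution σ T ρ u θ → ∀ Φ : (N : ℕ) → Literature.Analysis.FluidPDE.HardSphereFlow (Literature.Analysis.FluidPDE.Torus.geometry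 (Fin 3)) (Literature.MathematicalPhysics.KineticTheory.hsDiameter σ N) (N + 1), (∀ N, Measurable (fun p : ℝ × Literature.Analysis.FluidPDE.Config (N + 1) (Fin 3) Literature.MathematicalPhysics.KineticTheory.T3 => (Φ N).flow p.1 p.2)) → Literature.MathematicalPhysics.KineticTheory.TendstoHydroFieldsAt (fun N => Literature.MathematicalPhysics.KineticTheory.localGibbsLaw σ a₀ u₀ θ₀ N (Φ N)) Φ ρ u θ 0 → ∀ t ∈ Set.Ico 0 T, ∀ a : ℝ → Literature.MathematicalPhysics.KineticTheory.T3 → ℝ, Continuous (fun p : ℝ × Literature.MathematicalPhysics.KineticTheory.T3 => a p.1 p.2) → (∀ s x, 0 < a s x) → let G : Literature.Analysis.FluidPDE.Geometry (Fin 3) Literature.MathematicalPhysics.KineticTheory.T3 := Literature.Analysis.FluidPDE.Torus.geometry (Fin 3); let ε : ℕ → ℝ := fun N => Literature.MathematicalPhysics.KineticTheory.hsDiameter σ N; let P : (N : ℕ) → MeasureTheory.Measure (Literature.Analysis.FluidPDE.Config (N + 1) (Fin 3) Literature.MathematicalPhysics.KineticTheory.T3) := fun N => Literature.MathematicalPhysics.KineticTheory.localGibbsLaw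 σ a₀ u₀ θ₀ N (Φ N); let W : (N : ℕ) → ℝ → Literature.Analysis.FluidPDE.Config (N + 1) (Fin 3) Literature.MathematicalPhysics.KineticTheory.T3 → ℝ := fun N s => (Literature.Analysis.FluidPDE.hardSphereDomain G (N + 1) (ε N)).indicator (Literature.Analysis.FluidPDE.hsTransport (Φ N) s (Literature.Analysis.FluidPDE.canonicalDensity G (ε N) (N + 1) (Literature.MathematicalPhysics.KineticTheory.localGibbsProfile a₀ u₀ θ₀))); let F1 : ℕ → ℝ → Literature.MathematicalPhysics.KineticTheory.T3 × Literature.MathematicalPhysics.KineticTheory.V3 → ℝ := fun N s y => Literature.Analysis.FluidPDE.nthMarginal (N + 1) 1 (W N s) (fun _ => y); let ρF : ℕ → ℝ → Literature.MathematicalPhysics.KineticTheory.T3 → ℝ := fun N s x => ∫ v, F1 N s (x, v); let Sden : ℕ → ENNReal := fun N => ∫⁻ s in Set.Ioo 0 t, ∫⁻ x : Literature.MathematicalPhysics.KineticTheory.T3, ENNReal.ofReal ((ρF N s x - ρ s x) ^ 2); ∃ C : NNReal, ∃ δ : ℕ → ENNReal, Filter.Tendsto δ Filter.atTop (nhds 0)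 ∧ ∀ N : ℕ, Sden N ≤ (C : ENNReal) * (∫⁻ s in Set.Ioo 0 t, InformationTheory.klDiv ((Φ N).lawAt (P N) s) (Literature.MathematicalPhysics.KineticTheory.localGibbsLaw σ (a s) (u s) (θ s) N (Φ N))) / ((N : ENNReal) + 1) + δ N

/-- **Composition of asymptotic linear bounds (the assembly's analytic core).** If
`Q_N ≤ C₁(S^v_N + S^d_N) + δ¹_N`, `S^v_N ≤ C₂·K_N/(N+1) + δ²_N` and `S^d_N ≤ C₃·K_N/(N+1) + δ³_N` with
`δⁱ_N → 0` in `ℝ≥0∞`, then `Q_N ≤ C₁(C₂+C₃)·K_N/(N+1) + (C₁(δ²_N+δ³_N) + δ¹_N)` and the new error tends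
to `0` (`C₁ < ∞`). [folklore] -/
theorem asymptoticBound_chain {Q Sv Sd K : ℕ → ℝ≥0∞}
    (hR : ∃ C : ℝ≥0, ∃ δ : ℕ → ℝ≥0∞, Tendsto δ atTop (𝓝 0) ∧
      ∀ N : ℕ, Q N ≤ (C : ℝ≥0∞) * (Sv N + Sd N) + δ N)
    (hV : ∃ C : ℝ≥0, ∃ δ : ℕ → ℝ≥0∞, Tendsto δ atTop (𝓝 0) ∧
      ∀ N : ℕ, Sv N ≤ (C : ℝ≥0∞) * K N / ((N : ℝ≥0∞) + 1) + δ N)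
    (hD : ∃ C : ℝ≥0, ∃ δ : ℕ → ℝ≥0∞, Tendsto δ atTop (𝓝 0) ∧
      ∀ N : ℕ, Sd N ≤ (C : ℝ≥0∞) * K N / ((N : ℝ≥0∞) + 1) + δ N) :
    ∃ C : ℝ≥0, ∃ δ : ℕ → ℝ≥0∞, Tendsto δ atTop (𝓝 0) ∧
      ∀ N : ℕ, Q N ≤ (C : ℝ≥0∞) * K N / ((N : ℝ≥0∞) + 1) + δ N := by
  obtain ⟨C₁, δ₁, hδ₁, h₁⟩ := hR
  obtain ⟨C₂, δ₂, hδ₂, h₂⟩ := hV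
  obtain ⟨C₃, δ₃, hδ₃, h₃⟩ := hD
  refine ⟨C₁ * (C₂ + C₃), fun N => (C₁ : ℝ≥0∞) * (δ₂ N + δ₃ N) + δ₁ N, ?_, fun N => ?_⟩
  · -- the combined error `C₁(δ₂ + δ₃) + δ₁ → C₁·0 + 0 = 0`
    have h23 : Tendsto (fun N => δ₂ N + δ₃ N) atTop (𝓝 0) := by
      simpa using hδ₂.add hδ₃
    have hmul : Tendsto (fun N => (C₁ : ℝ≥0∞) * (δ₂ N + δ₃ N)) atTop (𝓝 0) := by
      simpa using ENNReal.Tendsto.const_mul h23 (Or.inr ENNReal.coe_ne_top)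
    simpa using hmul.add hδ₁
  · -- chain the three bounds and redistribute the constants
    calc Q N ≤ (C₁ : ℝ≥0∞) * (Sv N + Sd N) + δ₁ N := h₁ N
      _ ≤ (C₁ : ℝ≥0∞) * (((C₂ : ℝ≥0∞) * K N / ((N : ℝ≥0∞) + 1) + δ₂ N) +
            ((C₃ : ℝ≥0∞) * K N / ((N : ℝ≥0∞) + 1) + δ₃ N)) + δ₁ N := by
          gcongr
          · exact h₂ N
          · exact h₃ N
      _ = ((C₁ * (C₂ + C₃) : ℝ≥0) : ℝ≥0∞) * K N / ((N : ℝ≥0∞) + 1) +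
            ((C₁ : ℝ≥0∞) * (δ₂ N + δ₃ N) + δ₁ N) := by
          simp only [ENNReal.coe_mul, ENNReal.coe_add, div_eq_mul_inv]
          ring

/-- **The crux from its three pieces (BC2-redirect assembly).**
`ContactOnePointReduction → VelocityDeviationEntropyBound → DensityDeviationEntropyBound →
ContactBilinearEntropyBound` (route ChapmanEnskogBBGKY, stmt-AtomisticToContinuum-11892): fix the
profiles; take `σ₀ = min σ₀^vel σ₀^den`; for `σ < σ₀`, a classical hs-Euler solution, a measurable family
of flows tied at `t = 0`, `t < T` and an activity profile `a`, instantiate the kinematic reduction (valid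
at every `σ > 0`) and the two sector bounds on the SAME one-point functionals `S^vel_N, S^den_N` (the
`let`-bound objects are the crux's verbatim, so the three hypotheses and the goal ζ-reduce to one
family of terms) and compose them with `asymptoticBound_chain`. [folklore] -/
theorem contactBilinearEntropyBound_of_subs
    (hR : ContactOnePointReduction) (hV : VelocityDeviationEntropyBound)
    (hD : DensityDeviationEntropyBound) :
    Summit.AtomisticToContinuum.HydrodynamicLimit.Theses.ChapmanEnskogBBGKY.ContactBilinearEntropyBound := by
  intro a₀ θ₀ u₀ ha₀ hθ₀ hu₀ hap hθp
  obtain ⟨σ₂, hσ₂, HV⟩ := hV a₀ θ₀ u₀ ha₀ hθ₀ hu₀ hap hθp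
  obtain ⟨σ₃, hσ₃, HD⟩ := hD a₀ θ₀ u₀ ha₀ hθ₀ hu₀ hap hθp
  refine ⟨min σ₂ σ₃, lt_min hσ₂ hσ₃, ?_⟩
  intro σ hσ hσlt T ρ θ u hsol Φ hmeas h0 t ht a ha hapos
  have R := hR a₀ θ₀ u₀ ha₀ hθ₀ hu₀ hap hθp σ hσ T ρ θ u hsol Φ hmeas t ht
  have V := HV σ hσ (lt_of_lt_of_le hσlt (min_le_left _ _)) T ρ θ u hsol Φ hmeas h0 t ht a ha hapos
  have D := HD σ hσ (lt_of_lt_of_le hσlt (min_le_right _ _)) T ρ θ u hsol Φ hmeas h0 t ht a ha hapos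
  exact asymptoticBound_chain R V D

end Summit.AtomisticToContinuum.HydrodynamicLimit.Theorems
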